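import Literature.AlgebraicGeometry.PlaneCurves.HessePencilHessianGroup
import Mathlib.LinearAlgebra.CrossProduct
import HarnessLib

/-!
# The configuration of the Halphen cubics at the vertices of the inflection triangles
# (Artebani–Dolgachev, Proposition 5.2 i)–iii), the printed examples)

Topic `Literature/AlgebraicGeometry/PlaneCurves`, namespace
`Literature.AlgebraicGeometry.PlaneCurves`.
Lane `lit-hodgefound`, seat `lit-hodgefound-p37`, row g19-#9; a one-file sequel of the seat's
`HessePencilEightCubics` (g19-#3: the inflection triangles of the `Bᵢ`, `B₂` and `B₁` inscribed and
circumscribed in the triangles) and `HessePencilHalphenCubics` (g19-#7).  Prop. 5.2 ends with a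
precise incidence configuration of the eight cubics at the twelve vertices; the source proves it by
"it is enough, using the `G₂₁₆`-action, to consider one of the curves" and PRINTS two examples.
This file proves statement i) for the pair `(B₁, B₁′ = B₅)` and the two printed examples of ii)
and iii), as explicit value/gradient computations at the printed vertices.  Everything here is
PROVED; no definition, no named fact.

Source followed — M. Artebani, I. Dolgachev, *The Hesse pencil of plane cubic curves*, Enseign.
Math. 55 (2009) 235–273, §5, Prop. 5.2 and its proof [held `paper:arxiv-math_0611590` p0011
L17–L26], VERBATIM (`ε = ω`):

> To check the last assertion it is enough, using the `G₂₁₆`-action, to consider one of the curves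
> `Bᵢ`. […] More precisely we have the following configuration:
> i) `Bᵢ` and `Bᵢ₊₄` have `Tᵢ` as a common inflection triangle and they intersect in the `9`
> vertices of the other triangles;
> ii) `Bᵢ` and `Bⱼ`, `i ≠ j`, `i, j ≤ 4`, intersect in the `3` vertices of a triangle `T_k` and they
> are tangent in the `3` vertices of `T_ℓ` with `k, ℓ ∉ {i, j}`;
> iii) `Bᵢ` and `Bⱼ₊₄`, `i ≠ j`, `i, j ≤ 4`, intersect similarly with `k` and `ℓ` interchanged.
> For example, `B₁` and `B₂` intersect in the vertices of `T₃` and are tangent in the vertices of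
> `T₄`, while `B₁` and `B₆` intersect transversally on `T₄` and are tangent on `T₃`.

and §2 [p0005 L36–L52]: the triangles `T₁ = E_∞ : xyz = 0`, `T₂ = E_{−3} :
(x+y+z)(x+εy+ε²z)(x+ε²y+εz) = 0`,
`T₃ = E_{−3ε} : (x+εy+z)(x+ε²y+ε²z)(x+y+εz) = 0`, `T₄ = E_{−3ε²} : (x+ε²y+z)(x+εy+εz)(x+y+ε²z) = 0`
and the vertices `v₀ = (1,0,0), …, v₃ = (1,1,1), v₄ = (1,ε,ε²), v₅ = (1,ε²,ε), v₆ = (ε,1,1),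
v₇ = (1,ε,1), v₈ = (1,1,ε), v₉ = (ε²,1,1), v₁₀ = (1,ε²,1), v₁₁ = (1,1,ε²)`; §5 (B1)–(B8):
`B₁ = x³ + εy³ + ε²z³`, `B₅ = x³ + ε²y³ + εz³`, `B₂ = x²y + y²z + z²x`, `B₆ = x²z + y²x + z²y`.

## Dictionary

* `ω ∈ K` with `ω² + ω + 1 = 0` is `ε`.  The vertices of `T₂` are `v₃, v₄, v₅`; the vertices of
  `T₃ = E_{−3ε}` are `v₉, v₁₀, v₁₁ = (ε²,1,1), (1,ε²,1), (1,1,ε²)` (pairwise intersections of its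
  three sides) and those of `T₄ = E_{−3ε²}` are `v₆, v₇, v₈ = (ε,1,1), (1,ε,1), (1,1,ε)` — each
    listed
  vertex is checked below to lie on a side `ℓ` of the triangle in question (`ℓ ⬝ᵥ v = 0`).
* "`B` and `B′` intersect transversally at `v`" `:=` `B(v) = B′(v) = 0` and the tangent lines there
  are distinct, written as `∇B(v) × ∇B′(v) = c·v` with an explicit scalar `c` (the cross product of
  the two tangent lines is their intersection point, `v` itself; `c ≠ 0` when `3 ≠ 0`,
  `halphen_configuration_scalars_ne_zero`).
* "`B` and `B′` are tangent at the vertex `v` of `T`" `:=` `B(v) = B′(v) = 0` and both gradients are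
  (explicit, non-zero when `3 ≠ 0`) multiples of the side `ℓ` of `T` through `v`: the common tangent
  IS a side of the triangle (cf. `HessePencilEightCubics`: inscribed and circumscribed).
* "common inflection triangle `T₁`" of `B₁, B₅` is `HessePencilEightCubics.det_hessianMatrix_B₁`
  (`He(x³ + ay³ + bz³) = 216ab·xyz`), not repeated here.

## What is proved (`K` a field, `ω² + ω + 1 = 0`)

* §1 **i) for `(B₁, B₅)`**: `halphen_B₁_B₅_vertices_T₂`, `_T₃`, `_T₄` — at each of the nine
  vertices `v₃, …, v₁₁` of `T₂, T₃, T₄` both `B₁` and `B₅` vanish and `∇B₁ × ∇B₅ = c·v` with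
  `c ∈ {−9(2ω+1), 9(ω+2), 9(ω−1)}`.
* §2 **ii), the printed example `(B₁, B₂)`**: `halphen_B₁_B₂_transversal_T₃` (at `v₉, v₁₀, v₁₁`:
  both vanish, `∇B₁ × ∇B₂ = c·v`, `c ∈ {−9, −9ω, 9ω+9}`) and `halphen_B₁_B₂_tangent_T₄` (at
  `v₆, v₇, v₈`: both vanish, the vertex lies on the side `ℓ ∈ {x+ε²y+z, x+y+ε²z, x+εy+εz}` of `T₄`,
  and `∇B₁ = c₁ℓ`, `∇B₂ = c₂ℓ` with explicit `c₁ ∈ {−3ω−3, 3}`, `c₂ ∈ {2ω+1, 1−ω}`).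
* §3 **iii), the printed example `(B₁, B₆)`**: `halphen_B₁_B₆_transversal_T₄`,
  `halphen_B₁_B₆_tangent_T₃` (the same with `T₃`, `T₄` interchanged).
* §4 `halphen_configuration_scalars_ne_zero`: for `3 ≠ 0` all the scalars above are non-zero
  (`2ω+1`, `ω+2`, `ω−1`, `ω`, `ω+1`, `9 ≠ 0`).

NOT here: the general ii)/iii) for all pairs (the source reduces them to the examples by the
`G₂₁₆`-action of `HessePencilHalphenCubics`), and that these are ALL the intersection points
(Bezout: `3·1 + 3·2 = 9`).

## References

* [ArtebaniDolgachev2009] M. Artebani, I. Dolgachev, *The Hesse pencil of plane cubic curves*,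
  Enseign. Math. (2) 55 (2009) 235–273, §2 (triangles and vertices), §5, Prop. 5.2 (i)–(iii).
-/

set_option autoImplicit false

open MvPolynomial Matrix

namespace Literature.AlgebraicGeometry.PlaneCurves

universe u

/-- `B₁ = x³ + εy³ + ε²z³` (local notation, no definition). -/
local notation3 "𝐁₁[" ω "]" =>
  (X 0 ^ 3 + C ω * X 1 ^ 3 + C (ω ^ 2) * X 2 ^ 3 : MvPolynomial (Fin 3) _)

/-- `B₅ = B₁′ = x³ + ε²y³ + εz³` (local notation, no definition). -/
local notation3 "𝐁₅[" ω "]" =>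
  (X 0 ^ 3 + C (ω ^ 2) * X 1 ^ 3 + C ω * X 2 ^ 3 : MvPolynomial (Fin 3) _)

/-- `B₂ = x²y + y²z + z²x` (local notation, no definition). -/
local notation3 "𝐁₂" => (X 0 ^ 2 * X 1 + X 1 ^ 2 * X 2 + X 2 ^ 2 * X 0 : MvPolynomial (Fin 3) _)

/-- `B₆ = B₂′ = x²z + y²x + z²y` (local notation, no definition). -/
local notation3 "𝐁₆" => (X 0 ^ 2 * X 2 + X 1 ^ 2 * X 0 + X 2 ^ 2 * X 1 : MvPolynomial (Fin 3) _)

section HalphenConfiguration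

variable {K : Type u} [Field K]

/-! ## §0 Plumbing -/

omit [Field K] in
/-- `![a, b, c] = ![a′, b′, c′]` componentwise. [folklore] -/
private theorem vec3_eq_iff (a b c a' b' c' : K) :
    (![a, b, c] : Fin 3 → K) = ![a', b', c'] ↔ a = a' ∧ b = b' ∧ c = c' := by
  constructor
  · intro h
    exact ⟨by simpa using congr_fun h 0, by simpa using congr_fun h 1, by simpa using congr_fun h 2⟩
  · rintro ⟨rfl, rfl, rfl⟩
    rfl

/-- `B₁(p)` and `∇B₁(p) = (3p₀², 3ωp₁², 3ω²p₂²)`. [folklore] -/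
private theorem B₁_eval (ω : K) (p : Fin 3 → K) :
    eval p (𝐁₁[ω] : MvPolynomial (Fin 3) K) = p 0 ^ 3 + ω * p 1 ^ 3 + ω ^ 2 * p 2 ^ 3 ∧
      (fun i => eval p (pderiv i (𝐁₁[ω] : MvPolynomial (Fin 3) K))) =
        ![3 * p 0 ^ 2, 3 * ω * p 1 ^ 2, 3 * ω ^ 2 * p 2 ^ 2] := by
  refine ⟨by simp, ?_⟩
  funext i
  fin_cases i <;> simp [pderiv_X, map_ofNat] <;> ring

/-- `B₅(p)` and `∇B₅(p) = (3p₀², 3ω²p₁², 3ωp₂²)`. [folklore] -/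
private theorem B₅_eval (ω : K) (p : Fin 3 → K) :
    eval p (𝐁₅[ω] : MvPolynomial (Fin 3) K) = p 0 ^ 3 + ω ^ 2 * p 1 ^ 3 + ω * p 2 ^ 3 ∧
      (fun i => eval p (pderiv i (𝐁₅[ω] : MvPolynomial (Fin 3) K))) =
        ![3 * p 0 ^ 2, 3 * ω ^ 2 * p 1 ^ 2, 3 * ω * p 2 ^ 2] := by
  refine ⟨by simp, ?_⟩
  funext i
  fin_cases i <;> simp [pderiv_X, map_ofNat] <;> ring

/-- `B₂(p)` and `∇B₂(p) = (2p₀p₁ + p₂², p₀² + 2p₁p₂, p₁² + 2p₂p₀)`. [folklore] -/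
private theorem B₂_eval (p : Fin 3 → K) :
    eval p (𝐁₂ : MvPolynomial (Fin 3) K) = p 0 ^ 2 * p 1 + p 1 ^ 2 * p 2 + p 2 ^ 2 * p 0 ∧
      (fun i => eval p (pderiv i (𝐁₂ : MvPolynomial (Fin 3) K))) =
        ![2 * p 0 * p 1 + p 2 ^ 2, p 0 ^ 2 + 2 * p 1 * p 2, p 1 ^ 2 + 2 * p 2 * p 0] := by
  refine ⟨by simp, ?_⟩
  funext i
  fin_cases i <;> simp [pderiv_X, map_ofNat] <;> ring

/-- `B₆(p)` and `∇B₆(p) = (2p₀p₂ + p₁², 2p₀p₁ + p₂², p₀² + 2p₁p₂)`. [folklore] -/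
private theorem B₆_eval (p : Fin 3 → K) :
    eval p (𝐁₆ : MvPolynomial (Fin 3) K) = p 0 ^ 2 * p 2 + p 1 ^ 2 * p 0 + p 2 ^ 2 * p 1 ∧
      (fun i => eval p (pderiv i (𝐁₆ : MvPolynomial (Fin 3) K))) =
        ![2 * p 0 * p 2 + p 1 ^ 2, 2 * p 0 * p 1 + p 2 ^ 2, p 0 ^ 2 + 2 * p 1 * p 2] := by
  refine ⟨by simp, ?_⟩
  funext i
  fin_cases i <;> simp [pderiv_X, map_ofNat] <;> ring

/-! ## §1 i): `B₁` and `B₁′ = B₅` intersect transversally in the nine vertices of `T₂, T₃, T₄` -/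

/-- **i) "`Bᵢ` and `Bᵢ₊₄` … intersect in the `9` vertices of the other triangles"**, `i = 1`, at the
vertices `v₃ = (1,1,1), v₄ = (1,ε,ε²), v₅ = (1,ε²,ε)` of `T₂`: both `B₁` and `B₅` vanish, and
their tangent lines there are distinct — `∇B₁(v) × ∇B₅(v) = c·v` with `c = −9(2ω+1)` (up to the
printed representative; `ω² + ω + 1 = 0`; `c ≠ 0` when `3 ≠ 0`, §4).
[cite: ArtebaniDolgachev2009, §5, Prop. 5.2 (i)] -/
theorem halphen_B₁_B₅_vertices_T₂ {ω : K} (hω : ω ^ 2 + ω + 1 = 0) :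
      (eval ![(1 : K), 1, 1] (𝐁₁[ω] : MvPolynomial (Fin 3) K) = 0 ∧ eval ![(1 : K), 1, 1] (𝐁₅[ω] :
        MvPolynomial (Fin 3) K) = 0 ∧
        crossProduct (fun i => eval ![(1 : K), 1, 1] (pderiv i (𝐁₁[ω] : MvPolynomial (Fin 3) K)))
          (fun i => eval ![(1 : K), 1, 1] (pderiv i (𝐁₅[ω] : MvPolynomial (Fin 3) K))) =
          (-18 * ω - 9 : K) • ![(1 : K), 1, 1]) ∧
      (eval ![(1 : K), ω, ω ^ 2] (𝐁₁[ω] : MvPolynomial (Fin 3) K) = 0 ∧ eval ![(1 : K), ω, ω ^ 2]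
        (𝐁₅[ω] : MvPolynomial (Fin 3) K) = 0 ∧
        crossProduct (fun i => eval ![(1 : K), ω, ω ^ 2] (pderiv i (𝐁₁[ω] : MvPolynomial (Fin 3)
          K))) (fun i => eval ![(1 : K), ω, ω ^ 2] (pderiv i (𝐁₅[ω] : MvPolynomial (Fin 3) K))) =
          (-18 * ω - 9 : K) • ![(1 : K), ω, ω ^ 2]) ∧
      (eval ![(1 : K), ω ^ 2, ω] (𝐁₁[ω] : MvPolynomial (Fin 3) K) = 0 ∧ eval ![(1 : K), ω ^ 2, ω]
        (𝐁₅[ω] : MvPolynomial (Fin 3) K) = 0 ∧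
        crossProduct (fun i => eval ![(1 : K), ω ^ 2, ω] (pderiv i (𝐁₁[ω] : MvPolynomial (Fin 3)
          K))) (fun i => eval ![(1 : K), ω ^ 2, ω] (pderiv i (𝐁₅[ω] : MvPolynomial (Fin 3) K))) =
          (-18 * ω - 9 : K) • ![(1 : K), ω ^ 2, ω]) := by
  refine ⟨⟨?_, ?_, ?_⟩, ⟨?_, ?_, ?_⟩, ⟨?_, ?_, ?_⟩⟩
  · rw [(B₁_eval ω _).1]
    simp only [Matrix.cons_val_zero, Matrix.cons_val_one, Matrix.cons_val_two, Matrix.head_cons,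
      Matrix.tail_cons]
    linear_combination (1) * hω
  · rw [(B₅_eval ω _).1]
    simp only [Matrix.cons_val_zero, Matrix.cons_val_one, Matrix.cons_val_two, Matrix.head_cons,
      Matrix.tail_cons]
    linear_combination (1) * hω
  · rw [(B₁_eval ω _).2, (B₅_eval ω _).2, cross_apply]
    simp only [Matrix.smul_cons, Matrix.smul_empty, smul_eq_mul, Matrix.cons_val_zero,
      Matrix.cons_val_one, Matrix.cons_val_two, Matrix.head_cons,
      Matrix.tail_cons, vec3_eq_iff]
    refine ⟨?_, ?_, ?_⟩
    · linear_combination (-9 * ω ^ 2 + 9 * ω + 9) * hω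
    · linear_combination (9) * hω
    · linear_combination (9) * hω
  · rw [(B₁_eval ω _).1]
    simp only [Matrix.cons_val_zero, Matrix.cons_val_one, Matrix.cons_val_two, Matrix.head_cons,
      Matrix.tail_cons]
    linear_combination (ω ^ 6 - (ω ^ 5) + ω ^ 3 - (ω) + 1) * hω
  · rw [(B₅_eval ω _).1]
    simp only [Matrix.cons_val_zero, Matrix.cons_val_one, Matrix.cons_val_two, Matrix.head_cons,
      Matrix.tail_cons]
    linear_combination (ω ^ 5 - (ω ^ 4) + ω ^ 3 - (ω) + 1) * hω
  · rw [(B₁_eval ω _).2, (B₅_eval ω _).2, cross_apply]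
    simp only [Matrix.smul_cons, Matrix.smul_empty, smul_eq_mul, Matrix.cons_val_zero,
      Matrix.cons_val_one, Matrix.cons_val_two, Matrix.head_cons,
      Matrix.tail_cons, vec3_eq_iff]
    refine ⟨?_, ?_, ?_⟩
    · linear_combination (-9 * ω ^ 8 + 9 * ω ^ 7 + 9 * ω ^ 6 - 18 * ω ^ 5 + 9 * ω ^ 4 + 9 * ω ^ 3 -
        18 * ω ^ 2 + 9 * ω + 9) * hω
    · linear_combination (9 * ω ^ 4 - 18 * ω ^ 3 + 9 * ω ^ 2 + 9 * ω) * hω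
    · linear_combination (9 * ω ^ 2) * hω
  · rw [(B₁_eval ω _).1]
    simp only [Matrix.cons_val_zero, Matrix.cons_val_one, Matrix.cons_val_two, Matrix.head_cons,
      Matrix.tail_cons]
    linear_combination (ω ^ 5 - (ω ^ 4) + ω ^ 3 - (ω) + 1) * hω
  · rw [(B₅_eval ω _).1]
    simp only [Matrix.cons_val_zero, Matrix.cons_val_one, Matrix.cons_val_two, Matrix.head_cons,
      Matrix.tail_cons]
    linear_combination (ω ^ 6 - (ω ^ 5) + ω ^ 3 - (ω) + 1) * hω
  · rw [(B₁_eval ω _).2, (B₅_eval ω _).2, cross_apply]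
    simp only [Matrix.smul_cons, Matrix.smul_empty, smul_eq_mul, Matrix.cons_val_zero,
      Matrix.cons_val_one, Matrix.cons_val_two, Matrix.head_cons,
      Matrix.tail_cons, vec3_eq_iff]
    refine ⟨?_, ?_, ?_⟩
    · linear_combination (-9 * ω ^ 8 + 9 * ω ^ 7 + 9 * ω ^ 6 - 18 * ω ^ 5 + 9 * ω ^ 4 + 9 * ω ^ 3 -
        18 * ω ^ 2 + 9 * ω + 9) * hω
    · linear_combination (9 * ω ^ 2) * hω
    · linear_combination (9 * ω ^ 4 - 18 * ω ^ 3 + 9 * ω ^ 2 + 9 * ω) * hω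

/-- **i) "`Bᵢ` and `Bᵢ₊₄` … intersect in the `9` vertices of the other triangles"**, `i = 1`, at the
vertices `v₉ = (ε²,1,1), v₁₀ = (1,ε²,1), v₁₁ = (1,1,ε²)` of `T₃`: both `B₁` and `B₅` vanish, and
their tangent lines there are distinct — `∇B₁(v) × ∇B₅(v) = c·v` with `c = 9(ω+2)` (up to the
printed representative; `ω² + ω + 1 = 0`; `c ≠ 0` when `3 ≠ 0`, §4).
[cite: ArtebaniDolgachev2009, §5, Prop. 5.2 (i)] -/
theorem halphen_B₁_B₅_vertices_T₃ {ω : K} (hω : ω ^ 2 + ω + 1 = 0) :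
      (eval ![ω ^ 2, (1 : K), 1] (𝐁₁[ω] : MvPolynomial (Fin 3) K) = 0 ∧ eval ![ω ^ 2, (1 : K), 1]
        (𝐁₅[ω] : MvPolynomial (Fin 3) K) = 0 ∧
        crossProduct (fun i => eval ![ω ^ 2, (1 : K), 1] (pderiv i (𝐁₁[ω] : MvPolynomial (Fin 3)
          K))) (fun i => eval ![ω ^ 2, (1 : K), 1] (pderiv i (𝐁₅[ω] : MvPolynomial (Fin 3) K))) =
          (9 * ω + 18 : K) • ![ω ^ 2, (1 : K), 1]) ∧
      (eval ![(1 : K), ω ^ 2, 1] (𝐁₁[ω] : MvPolynomial (Fin 3) K) = 0 ∧ eval ![(1 : K), ω ^ 2, 1]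
        (𝐁₅[ω] : MvPolynomial (Fin 3) K) = 0 ∧
        crossProduct (fun i => eval ![(1 : K), ω ^ 2, 1] (pderiv i (𝐁₁[ω] : MvPolynomial (Fin 3)
          K))) (fun i => eval ![(1 : K), ω ^ 2, 1] (pderiv i (𝐁₅[ω] : MvPolynomial (Fin 3) K))) =
          (9 * ω + 18 : K) • ![(1 : K), ω ^ 2, 1]) ∧
      (eval ![(1 : K), 1, ω ^ 2] (𝐁₁[ω] : MvPolynomial (Fin 3) K) = 0 ∧ eval ![(1 : K), 1, ω ^ 2]
        (𝐁₅[ω] : MvPolynomial (Fin 3) K) = 0 ∧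
        crossProduct (fun i => eval ![(1 : K), 1, ω ^ 2] (pderiv i (𝐁₁[ω] : MvPolynomial (Fin 3)
          K))) (fun i => eval ![(1 : K), 1, ω ^ 2] (pderiv i (𝐁₅[ω] : MvPolynomial (Fin 3) K))) =
          (9 * ω + 18 : K) • ![(1 : K), 1, ω ^ 2]) := by
  refine ⟨⟨?_, ?_, ?_⟩, ⟨?_, ?_, ?_⟩, ⟨?_, ?_, ?_⟩⟩
  · rw [(B₁_eval ω _).1]
    simp only [Matrix.cons_val_zero, Matrix.cons_val_one, Matrix.cons_val_two, Matrix.head_cons,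
      Matrix.tail_cons]
    linear_combination (ω ^ 4 - (ω ^ 3) + ω) * hω
  · rw [(B₅_eval ω _).1]
    simp only [Matrix.cons_val_zero, Matrix.cons_val_one, Matrix.cons_val_two, Matrix.head_cons,
      Matrix.tail_cons]
    linear_combination (ω ^ 4 - (ω ^ 3) + ω) * hω
  · rw [(B₁_eval ω _).2, (B₅_eval ω _).2, cross_apply]
    simp only [Matrix.smul_cons, Matrix.smul_empty, smul_eq_mul, Matrix.cons_val_zero,
      Matrix.cons_val_one, Matrix.cons_val_two, Matrix.head_cons,
      Matrix.tail_cons, vec3_eq_iff]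
    refine ⟨?_, ?_, ?_⟩
    · linear_combination (-9 * ω ^ 2) * hω
    · linear_combination (9 * ω ^ 4 - 18 * ω ^ 3 + 9 * ω ^ 2 + 9 * ω - 18) * hω
    · linear_combination (9 * ω ^ 4 - 18 * ω ^ 3 + 9 * ω ^ 2 + 9 * ω - 18) * hω
  · rw [(B₁_eval ω _).1]
    simp only [Matrix.cons_val_zero, Matrix.cons_val_one, Matrix.cons_val_two, Matrix.head_cons,
      Matrix.tail_cons]
    linear_combination (ω ^ 5 - (ω ^ 4) + ω ^ 2 - (ω) + 1) * hω
  · rw [(B₅_eval ω _).1]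
    simp only [Matrix.cons_val_zero, Matrix.cons_val_one, Matrix.cons_val_two, Matrix.head_cons,
      Matrix.tail_cons]
    linear_combination (ω ^ 6 - (ω ^ 5) + ω ^ 3 - (ω ^ 2) + 1) * hω
  · rw [(B₁_eval ω _).2, (B₅_eval ω _).2, cross_apply]
    simp only [Matrix.smul_cons, Matrix.smul_empty, smul_eq_mul, Matrix.cons_val_zero,
      Matrix.cons_val_one, Matrix.cons_val_two, Matrix.head_cons,
      Matrix.tail_cons, vec3_eq_iff]
    refine ⟨?_, ?_, ?_⟩
    · linear_combination (-9 * ω ^ 6 + 9 * ω ^ 5 + 9 * ω ^ 4 - 18 * ω ^ 3 + 9 * ω ^ 2 + 9 * ω - 18)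
        * hω
    · linear_combination (-9 * ω) * hω
    · linear_combination (9 * ω ^ 4 - 18 * ω ^ 3 + 9 * ω ^ 2 + 9 * ω - 18) * hω
  · rw [(B₁_eval ω _).1]
    simp only [Matrix.cons_val_zero, Matrix.cons_val_one, Matrix.cons_val_two, Matrix.head_cons,
      Matrix.tail_cons]
    linear_combination (ω ^ 6 - (ω ^ 5) + ω ^ 3 - (ω ^ 2) + 1) * hω
  · rw [(B₅_eval ω _).1]
    simp only [Matrix.cons_val_zero, Matrix.cons_val_one, Matrix.cons_val_two, Matrix.head_cons,
      Matrix.tail_cons]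
    linear_combination (ω ^ 5 - (ω ^ 4) + ω ^ 2 - (ω) + 1) * hω
  · rw [(B₁_eval ω _).2, (B₅_eval ω _).2, cross_apply]
    simp only [Matrix.smul_cons, Matrix.smul_empty, smul_eq_mul, Matrix.cons_val_zero,
      Matrix.cons_val_one, Matrix.cons_val_two, Matrix.head_cons,
      Matrix.tail_cons, vec3_eq_iff]
    refine ⟨?_, ?_, ?_⟩
    · linear_combination (-9 * ω ^ 6 + 9 * ω ^ 5 + 9 * ω ^ 4 - 18 * ω ^ 3 + 9 * ω ^ 2 + 9 * ω - 18)
        * hω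
    · linear_combination (9 * ω ^ 4 - 18 * ω ^ 3 + 9 * ω ^ 2 + 9 * ω - 18) * hω
    · linear_combination (-9 * ω) * hω

/-- **i) "`Bᵢ` and `Bᵢ₊₄` … intersect in the `9` vertices of the other triangles"**, `i = 1`, at the
vertices `v₆ = (ε,1,1), v₇ = (1,ε,1), v₈ = (1,1,ε)` of `T₄`: both `B₁` and `B₅` vanish, and
their tangent lines there are distinct — `∇B₁(v) × ∇B₅(v) = c·v` with `c = 9(ω−1)` (up to the
printed representative; `ω² + ω + 1 = 0`; `c ≠ 0` when `3 ≠ 0`, §4).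
[cite: ArtebaniDolgachev2009, §5, Prop. 5.2 (i)] -/
theorem halphen_B₁_B₅_vertices_T₄ {ω : K} (hω : ω ^ 2 + ω + 1 = 0) :
      (eval ![ω, (1 : K), 1] (𝐁₁[ω] : MvPolynomial (Fin 3) K) = 0 ∧ eval ![ω, (1 : K), 1] (𝐁₅[ω] :
        MvPolynomial (Fin 3) K) = 0 ∧
        crossProduct (fun i => eval ![ω, (1 : K), 1] (pderiv i (𝐁₁[ω] : MvPolynomial (Fin 3) K)))
          (fun i => eval ![ω, (1 : K), 1] (pderiv i (𝐁₅[ω] : MvPolynomial (Fin 3) K))) =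
          (9 * ω - 9 : K) • ![ω, (1 : K), 1]) ∧
      (eval ![(1 : K), ω, 1] (𝐁₁[ω] : MvPolynomial (Fin 3) K) = 0 ∧ eval ![(1 : K), ω, 1] (𝐁₅[ω] :
        MvPolynomial (Fin 3) K) = 0 ∧
        crossProduct (fun i => eval ![(1 : K), ω, 1] (pderiv i (𝐁₁[ω] : MvPolynomial (Fin 3) K)))
          (fun i => eval ![(1 : K), ω, 1] (pderiv i (𝐁₅[ω] : MvPolynomial (Fin 3) K))) =
          (9 * ω - 9 : K) • ![(1 : K), ω, 1]) ∧
      (eval ![(1 : K), 1, ω] (𝐁₁[ω] : MvPolynomial (Fin 3) K) = 0 ∧ eval ![(1 : K), 1, ω] (𝐁₅[ω] :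
        MvPolynomial (Fin 3) K) = 0 ∧
        crossProduct (fun i => eval ![(1 : K), 1, ω] (pderiv i (𝐁₁[ω] : MvPolynomial (Fin 3) K)))
          (fun i => eval ![(1 : K), 1, ω] (pderiv i (𝐁₅[ω] : MvPolynomial (Fin 3) K))) =
          (9 * ω - 9 : K) • ![(1 : K), 1, ω]) := by
  refine ⟨⟨?_, ?_, ?_⟩, ⟨?_, ?_, ?_⟩, ⟨?_, ?_, ?_⟩⟩
  · rw [(B₁_eval ω _).1]
    simp only [Matrix.cons_val_zero, Matrix.cons_val_one, Matrix.cons_val_two, Matrix.head_cons,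
      Matrix.tail_cons]
    linear_combination (ω) * hω
  · rw [(B₅_eval ω _).1]
    simp only [Matrix.cons_val_zero, Matrix.cons_val_one, Matrix.cons_val_two, Matrix.head_cons,
      Matrix.tail_cons]
    linear_combination (ω) * hω
  · rw [(B₁_eval ω _).2, (B₅_eval ω _).2, cross_apply]
    simp only [Matrix.smul_cons, Matrix.smul_empty, smul_eq_mul, Matrix.cons_val_zero,
      Matrix.cons_val_one, Matrix.cons_val_two, Matrix.head_cons,
      Matrix.tail_cons, vec3_eq_iff]
    refine ⟨?_, ?_, ?_⟩
    · linear_combination (-9 * ω ^ 2 + 9 * ω) * hω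
    · linear_combination (9 * ω ^ 2 - 18 * ω + 9) * hω
    · linear_combination (9 * ω ^ 2 - 18 * ω + 9) * hω
  · rw [(B₁_eval ω _).1]
    simp only [Matrix.cons_val_zero, Matrix.cons_val_one, Matrix.cons_val_two, Matrix.head_cons,
      Matrix.tail_cons]
    linear_combination (ω ^ 2 - (ω) + 1) * hω
  · rw [(B₅_eval ω _).1]
    simp only [Matrix.cons_val_zero, Matrix.cons_val_one, Matrix.cons_val_two, Matrix.head_cons,
      Matrix.tail_cons]
    linear_combination (ω ^ 3 - (ω ^ 2) + 1) * hω
  · rw [(B₁_eval ω _).2, (B₅_eval ω _).2, cross_apply]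
    simp only [Matrix.smul_cons, Matrix.smul_empty, smul_eq_mul, Matrix.cons_val_zero,
      Matrix.cons_val_one, Matrix.cons_val_two, Matrix.head_cons,
      Matrix.tail_cons, vec3_eq_iff]
    refine ⟨?_, ?_, ?_⟩
    · linear_combination (-9 * ω ^ 4 + 9 * ω ^ 3 + 9 * ω ^ 2 - 18 * ω + 9) * hω
    · ring
    · linear_combination (9 * ω ^ 2 - 18 * ω + 9) * hω
  · rw [(B₁_eval ω _).1]
    simp only [Matrix.cons_val_zero, Matrix.cons_val_one, Matrix.cons_val_two, Matrix.head_cons,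
      Matrix.tail_cons]
    linear_combination (ω ^ 3 - (ω ^ 2) + 1) * hω
  · rw [(B₅_eval ω _).1]
    simp only [Matrix.cons_val_zero, Matrix.cons_val_one, Matrix.cons_val_two, Matrix.head_cons,
      Matrix.tail_cons]
    linear_combination (ω ^ 2 - (ω) + 1) * hω
  · rw [(B₁_eval ω _).2, (B₅_eval ω _).2, cross_apply]
    simp only [Matrix.smul_cons, Matrix.smul_empty, smul_eq_mul, Matrix.cons_val_zero,
      Matrix.cons_val_one, Matrix.cons_val_two, Matrix.head_cons,
      Matrix.tail_cons, vec3_eq_iff]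
    refine ⟨?_, ?_, ?_⟩
    · linear_combination (-9 * ω ^ 4 + 9 * ω ^ 3 + 9 * ω ^ 2 - 18 * ω + 9) * hω
    · linear_combination (9 * ω ^ 2 - 18 * ω + 9) * hω
    · ring

/-! ## §2 ii), the printed example: `B₁` and `B₂` -/

/-- **"`B₁` and `B₂` intersect in the vertices of `T₃`"** (transversally): at
`v₉ = (ε²,1,1), v₁₀ = (1,ε²,1), v₁₁ = (1,1,ε²)` both vanish and `∇B₁ × ∇B₂ = c·v` with
`c = −9, −9ω, 9ω + 9` (`ω² + ω + 1 = 0`). [cite: ArtebaniDolgachev2009, §5, Prop. 5.2 (ii) and the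
example after iii)] -/
theorem halphen_B₁_B₂_transversal_T₃ {ω : K} (hω : ω ^ 2 + ω + 1 = 0) :
      (eval ![ω ^ 2, (1 : K), 1] (𝐁₁[ω] : MvPolynomial (Fin 3) K) = 0 ∧ eval ![ω ^ 2, (1 : K), 1]
        (𝐁₂ : MvPolynomial (Fin 3) K) = 0 ∧
        crossProduct (fun i => eval ![ω ^ 2, (1 : K), 1] (pderiv i (𝐁₁[ω] : MvPolynomial (Fin 3)
          K))) (fun i => eval ![ω ^ 2, (1 : K), 1] (pderiv i (𝐁₂ : MvPolynomial (Fin 3) K))) =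
          (-9 : K) • ![ω ^ 2, (1 : K), 1]) ∧
      (eval ![(1 : K), ω ^ 2, 1] (𝐁₁[ω] : MvPolynomial (Fin 3) K) = 0 ∧ eval ![(1 : K), ω ^ 2, 1]
        (𝐁₂ : MvPolynomial (Fin 3) K) = 0 ∧
        crossProduct (fun i => eval ![(1 : K), ω ^ 2, 1] (pderiv i (𝐁₁[ω] : MvPolynomial (Fin 3)
          K))) (fun i => eval ![(1 : K), ω ^ 2, 1] (pderiv i (𝐁₂ : MvPolynomial (Fin 3) K))) =
          (-9 * ω : K) • ![(1 : K), ω ^ 2, 1]) ∧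
      (eval ![(1 : K), 1, ω ^ 2] (𝐁₁[ω] : MvPolynomial (Fin 3) K) = 0 ∧ eval ![(1 : K), 1, ω ^ 2]
        (𝐁₂ : MvPolynomial (Fin 3) K) = 0 ∧
        crossProduct (fun i => eval ![(1 : K), 1, ω ^ 2] (pderiv i (𝐁₁[ω] : MvPolynomial (Fin 3)
          K))) (fun i => eval ![(1 : K), 1, ω ^ 2] (pderiv i (𝐁₂ : MvPolynomial (Fin 3) K))) =
          (9 * ω + 9 : K) • ![(1 : K), 1, ω ^ 2]) := by
  refine ⟨⟨?_, ?_, ?_⟩, ⟨?_, ?_, ?_⟩, ⟨?_, ?_, ?_⟩⟩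
  · rw [(B₁_eval ω _).1]
    simp only [Matrix.cons_val_zero, Matrix.cons_val_one, Matrix.cons_val_two, Matrix.head_cons,
      Matrix.tail_cons]
    linear_combination (ω ^ 4 - (ω ^ 3) + ω) * hω
  · rw [(B₂_eval _).1]
    simp only [Matrix.cons_val_zero, Matrix.cons_val_one, Matrix.cons_val_two, Matrix.head_cons,
      Matrix.tail_cons]
    linear_combination (ω ^ 2 - (ω) + 1) * hω
  · rw [(B₁_eval ω _).2, (B₂_eval _).2, cross_apply]
    simp only [Matrix.smul_cons, Matrix.smul_empty, smul_eq_mul, Matrix.cons_val_zero,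
      Matrix.cons_val_one, Matrix.cons_val_two, Matrix.head_cons,
      Matrix.tail_cons, vec3_eq_iff]
    refine ⟨?_, ?_, ?_⟩
    · linear_combination (-3 * ω ^ 4 + 3 * ω ^ 3 + 3 * ω) * hω
    · linear_combination (-6 * ω ^ 4 + 6 * ω ^ 3 + 3 * ω ^ 2 - 9 * ω + 9) * hω
    · linear_combination (3 * ω ^ 6 - 3 * ω ^ 5 + 3 * ω ^ 3 + 3 * ω ^ 2 - 12 * ω + 9) * hω
  · rw [(B₁_eval ω _).1]
    simp only [Matrix.cons_val_zero, Matrix.cons_val_one, Matrix.cons_val_two, Matrix.head_cons,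
      Matrix.tail_cons]
    linear_combination (ω ^ 5 - (ω ^ 4) + ω ^ 2 - (ω) + 1) * hω
  · rw [(B₂_eval _).1]
    simp only [Matrix.cons_val_zero, Matrix.cons_val_one, Matrix.cons_val_two, Matrix.head_cons,
      Matrix.tail_cons]
    linear_combination (ω ^ 2 - (ω) + 1) * hω
  · rw [(B₁_eval ω _).2, (B₂_eval _).2, cross_apply]
    simp only [Matrix.smul_cons, Matrix.smul_empty, smul_eq_mul, Matrix.cons_val_zero,
      Matrix.cons_val_one, Matrix.cons_val_two, Matrix.head_cons,
      Matrix.tail_cons, vec3_eq_iff]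
    refine ⟨?_, ?_, ?_⟩
    · linear_combination (3 * ω ^ 7 - 3 * ω ^ 6 + 3 * ω ^ 4 + 3 * ω ^ 3 - 12 * ω ^ 2 + 9 * ω) * hω
    · linear_combination (3 * ω ^ 2 + 6 * ω - 6) * hω
    · linear_combination (-6 * ω ^ 5 + 6 * ω ^ 4 - 3 * ω ^ 3 - 3 * ω ^ 2 + 6 * ω + 3) * hω
  · rw [(B₁_eval ω _).1]
    simp only [Matrix.cons_val_zero, Matrix.cons_val_one, Matrix.cons_val_two, Matrix.head_cons,
      Matrix.tail_cons]
    linear_combination (ω ^ 6 - (ω ^ 5) + ω ^ 3 - (ω ^ 2) + 1) * hω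
  · rw [(B₂_eval _).1]
    simp only [Matrix.cons_val_zero, Matrix.cons_val_one, Matrix.cons_val_two, Matrix.head_cons,
      Matrix.tail_cons]
    linear_combination (ω ^ 2 - (ω) + 1) * hω
  · rw [(B₁_eval ω _).2, (B₂_eval _).2, cross_apply]
    simp only [Matrix.smul_cons, Matrix.smul_empty, smul_eq_mul, Matrix.cons_val_zero,
      Matrix.cons_val_one, Matrix.cons_val_two, Matrix.head_cons,
      Matrix.tail_cons, vec3_eq_iff]
    refine ⟨?_, ?_, ?_⟩
    · linear_combination (-6 * ω ^ 6 + 6 * ω ^ 5 - 3 * ω ^ 4 - 3 * ω ^ 3 + 6 * ω ^ 2 + 3 * ω - 9) *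
        hω
    · linear_combination (3 * ω ^ 8 - 3 * ω ^ 7 + 3 * ω ^ 5 + 3 * ω ^ 4 - 6 * ω ^ 3 + 3 * ω ^ 2 + 3
        * ω - 12) * hω
    · linear_combination (-3 * ω ^ 3 + 3 * ω ^ 2 - 9 * ω + 3) * hω

/-- **"… and are tangent in the vertices of `T₄`"**: at `v₆ = (ε,1,1), v₇ = (1,ε,1), v₈ = (1,1,ε)`
both `B₁` and `B₂` vanish, the vertex lies on the side `ℓ = x + ε²y + z`, `x + y + ε²z`,
`x + εy + εz` of `T₄ = E_{−3ε²}` respectively, and BOTH gradients are multiples of that side: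
`∇B₁ = c₁ℓ`, `∇B₂ = c₂ℓ` (`c₁ = −3ω−3, 3, 3`; `c₂ = 2ω+1, 2ω+1, 1−ω`) — the two cubics are tangent
to
each other and to the triangle there (`ω² + ω + 1 = 0`). [cite: ArtebaniDolgachev2009, §5,
Prop. 5.2 (ii) and the example after iii)] -/
theorem halphen_B₁_B₂_tangent_T₄ {ω : K} (hω : ω ^ 2 + ω + 1 = 0) :
      (eval ![ω, (1 : K), 1] (𝐁₁[ω] : MvPolynomial (Fin 3) K) = 0 ∧ eval ![ω, (1 : K), 1] (𝐁₂ :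
        MvPolynomial (Fin 3) K) = 0 ∧ ![(1 : K), ω ^ 2, 1] ⬝ᵥ ![ω, (1 : K), 1] = 0 ∧
        (fun i => eval ![ω, (1 : K), 1] (pderiv i (𝐁₁[ω] : MvPolynomial (Fin 3) K))) = (-3 * ω - 3
          : K) • ![(1 : K), ω ^ 2, 1] ∧
        (fun i => eval ![ω, (1 : K), 1] (pderiv i (𝐁₂ : MvPolynomial (Fin 3) K))) = (2 * ω + 1 :
          K) • ![(1 : K), ω ^ 2, 1]) ∧
      (eval ![(1 : K), ω, 1] (𝐁₁[ω] : MvPolynomial (Fin 3) K) = 0 ∧ eval ![(1 : K), ω, 1] (𝐁₂ :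
        MvPolynomial (Fin 3) K) = 0 ∧ ![(1 : K), 1, ω ^ 2] ⬝ᵥ ![(1 : K), ω, 1] = 0 ∧
        (fun i => eval ![(1 : K), ω, 1] (pderiv i (𝐁₁[ω] : MvPolynomial (Fin 3) K))) = (3 : K) •
          ![(1 : K), 1, ω ^ 2] ∧
        (fun i => eval ![(1 : K), ω, 1] (pderiv i (𝐁₂ : MvPolynomial (Fin 3) K))) = (2 * ω + 1 :
          K) • ![(1 : K), 1, ω ^ 2]) ∧
      (eval ![(1 : K), 1, ω] (𝐁₁[ω] : MvPolynomial (Fin 3) K) = 0 ∧ eval ![(1 : K), 1, ω] (𝐁₂ :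
        MvPolynomial (Fin 3) K) = 0 ∧ ![(1 : K), ω, ω] ⬝ᵥ ![(1 : K), 1, ω] = 0 ∧
        (fun i => eval ![(1 : K), 1, ω] (pderiv i (𝐁₁[ω] : MvPolynomial (Fin 3) K))) = (3 : K) •
          ![(1 : K), ω, ω] ∧
        (fun i => eval ![(1 : K), 1, ω] (pderiv i (𝐁₂ : MvPolynomial (Fin 3) K))) = (-(ω) + 1 : K)
          • ![(1 : K), ω, ω]) := by
  refine ⟨⟨?_, ?_, ?_, ?_, ?_⟩, ⟨?_, ?_, ?_, ?_, ?_⟩, ⟨?_, ?_, ?_, ?_, ?_⟩⟩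
  · rw [(B₁_eval ω _).1]
    simp only [Matrix.cons_val_zero, Matrix.cons_val_one, Matrix.cons_val_two, Matrix.head_cons,
      Matrix.tail_cons]
    linear_combination (ω) * hω
  · rw [(B₂_eval _).1]
    simp only [Matrix.cons_val_zero, Matrix.cons_val_one, Matrix.cons_val_two, Matrix.head_cons,
      Matrix.tail_cons]
    linear_combination (1) * hω
  · simp only [dotProduct, Fin.sum_univ_three, Matrix.cons_val_zero, Matrix.cons_val_one,
      Matrix.cons_val_two, Matrix.head_cons,
      Matrix.tail_cons]
    linear_combination (1) * hω
  · rw [(B₁_eval ω _).2]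
    simp only [Matrix.smul_cons, Matrix.smul_empty, smul_eq_mul, Matrix.cons_val_zero,
      Matrix.cons_val_one, Matrix.cons_val_two, Matrix.head_cons,
      Matrix.tail_cons, vec3_eq_iff]
    refine ⟨?_, ?_, ?_⟩
    · linear_combination (3) * hω
    · linear_combination (3 * ω) * hω
    · linear_combination (3) * hω
  · rw [(B₂_eval _).2]
    simp only [Matrix.smul_cons, Matrix.smul_empty, smul_eq_mul, Matrix.cons_val_zero,
      Matrix.cons_val_one, Matrix.cons_val_two, Matrix.head_cons,
      Matrix.tail_cons, vec3_eq_iff]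
    refine ⟨?_, ?_, ?_⟩
    · ring
    · linear_combination (-2 * ω + 2) * hω
    · ring
  · rw [(B₁_eval ω _).1]
    simp only [Matrix.cons_val_zero, Matrix.cons_val_one, Matrix.cons_val_two, Matrix.head_cons,
      Matrix.tail_cons]
    linear_combination (ω ^ 2 - (ω) + 1) * hω
  · rw [(B₂_eval _).1]
    simp only [Matrix.cons_val_zero, Matrix.cons_val_one, Matrix.cons_val_two, Matrix.head_cons,
      Matrix.tail_cons]
    linear_combination (1) * hω
  · simp only [dotProduct, Fin.sum_univ_three, Matrix.cons_val_zero, Matrix.cons_val_one,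
      Matrix.cons_val_two, Matrix.head_cons,
      Matrix.tail_cons]
    linear_combination (1) * hω
  · rw [(B₁_eval ω _).2]
    simp only [Matrix.smul_cons, Matrix.smul_empty, smul_eq_mul, Matrix.cons_val_zero,
      Matrix.cons_val_one, Matrix.cons_val_two, Matrix.head_cons,
      Matrix.tail_cons, vec3_eq_iff]
    refine ⟨?_, ?_, ?_⟩
    · ring
    · linear_combination (3 * ω - 3) * hω
    · ring
  · rw [(B₂_eval _).2]
    simp only [Matrix.smul_cons, Matrix.smul_empty, smul_eq_mul, Matrix.cons_val_zero,
      Matrix.cons_val_one, Matrix.cons_val_two, Matrix.head_cons,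
      Matrix.tail_cons, vec3_eq_iff]
    refine ⟨?_, ?_, ?_⟩
    · ring
    · ring
    · linear_combination (-2 * ω + 2) * hω
  · rw [(B₁_eval ω _).1]
    simp only [Matrix.cons_val_zero, Matrix.cons_val_one, Matrix.cons_val_two, Matrix.head_cons,
      Matrix.tail_cons]
    linear_combination (ω ^ 3 - (ω ^ 2) + 1) * hω
  · rw [(B₂_eval _).1]
    simp only [Matrix.cons_val_zero, Matrix.cons_val_one, Matrix.cons_val_two, Matrix.head_cons,
      Matrix.tail_cons]
    linear_combination (1) * hω
  · simp only [dotProduct, Fin.sum_univ_three, Matrix.cons_val_zero, Matrix.cons_val_one,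
      Matrix.cons_val_two, Matrix.head_cons,
      Matrix.tail_cons]
    linear_combination (1) * hω
  · rw [(B₁_eval ω _).2]
    simp only [Matrix.smul_cons, Matrix.smul_empty, smul_eq_mul, Matrix.cons_val_zero,
      Matrix.cons_val_one, Matrix.cons_val_two, Matrix.head_cons,
      Matrix.tail_cons, vec3_eq_iff]
    refine ⟨?_, ?_, ?_⟩
    · ring
    · ring
    · linear_combination (3 * ω ^ 2 - 3 * ω) * hω
  · rw [(B₂_eval _).2]
    simp only [Matrix.smul_cons, Matrix.smul_empty, smul_eq_mul, Matrix.cons_val_zero,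
      Matrix.cons_val_one, Matrix.cons_val_two, Matrix.head_cons,
      Matrix.tail_cons, vec3_eq_iff]
    refine ⟨?_, ?_, ?_⟩
    · linear_combination (1) * hω
    · linear_combination (1) * hω
    · linear_combination (1) * hω

/-! ## §3 iii), the printed example: `B₁` and `B₆ = B₂′` -/

/-- **"`B₁` and `B₆` intersect transversally on `T₄`"**: at `v₆ = (ε,1,1), v₇ = (1,ε,1),
v₈ = (1,1,ε)` both vanish and `∇B₁ × ∇B₆ = c·v` with `c = 9, 9ω, −9ω − 9` (`ω² + ω + 1 = 0`).
[cite: ArtebaniDolgachev2009, §5, Prop. 5.2 (iii) and the example after it] -/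
theorem halphen_B₁_B₆_transversal_T₄ {ω : K} (hω : ω ^ 2 + ω + 1 = 0) :
      (eval ![ω, (1 : K), 1] (𝐁₁[ω] : MvPolynomial (Fin 3) K) = 0 ∧ eval ![ω, (1 : K), 1] (𝐁₆ :
        MvPolynomial (Fin 3) K) = 0 ∧
        crossProduct (fun i => eval ![ω, (1 : K), 1] (pderiv i (𝐁₁[ω] : MvPolynomial (Fin 3) K)))
          (fun i => eval ![ω, (1 : K), 1] (pderiv i (𝐁₆ : MvPolynomial (Fin 3) K))) =
          (9 : K) • ![ω, (1 : K), 1]) ∧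
      (eval ![(1 : K), ω, 1] (𝐁₁[ω] : MvPolynomial (Fin 3) K) = 0 ∧ eval ![(1 : K), ω, 1] (𝐁₆ :
        MvPolynomial (Fin 3) K) = 0 ∧
        crossProduct (fun i => eval ![(1 : K), ω, 1] (pderiv i (𝐁₁[ω] : MvPolynomial (Fin 3) K)))
          (fun i => eval ![(1 : K), ω, 1] (pderiv i (𝐁₆ : MvPolynomial (Fin 3) K))) =
          (9 * ω : K) • ![(1 : K), ω, 1]) ∧
      (eval ![(1 : K), 1, ω] (𝐁₁[ω] : MvPolynomial (Fin 3) K) = 0 ∧ eval ![(1 : K), 1, ω] (𝐁₆ :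
        MvPolynomial (Fin 3) K) = 0 ∧
        crossProduct (fun i => eval ![(1 : K), 1, ω] (pderiv i (𝐁₁[ω] : MvPolynomial (Fin 3) K)))
          (fun i => eval ![(1 : K), 1, ω] (pderiv i (𝐁₆ : MvPolynomial (Fin 3) K))) =
          (-9 * ω - 9 : K) • ![(1 : K), 1, ω]) := by
  refine ⟨⟨?_, ?_, ?_⟩, ⟨?_, ?_, ?_⟩, ⟨?_, ?_, ?_⟩⟩
  · rw [(B₁_eval ω _).1]
    simp only [Matrix.cons_val_zero, Matrix.cons_val_one, Matrix.cons_val_two, Matrix.head_cons,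
      Matrix.tail_cons]
    linear_combination (ω) * hω
  · rw [(B₆_eval _).1]
    simp only [Matrix.cons_val_zero, Matrix.cons_val_one, Matrix.cons_val_two, Matrix.head_cons,
      Matrix.tail_cons]
    linear_combination (1) * hω
  · rw [(B₁_eval ω _).2, (B₆_eval _).2, cross_apply]
    simp only [Matrix.smul_cons, Matrix.smul_empty, smul_eq_mul, Matrix.cons_val_zero,
      Matrix.cons_val_one, Matrix.cons_val_two, Matrix.head_cons,
      Matrix.tail_cons, vec3_eq_iff]
    refine ⟨?_, ?_, ?_⟩
    · linear_combination (-3 * ω) * hω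
    · linear_combination (-3 * ω ^ 2 + 9 * ω - 9) * hω
    · linear_combination (6 * ω - 9) * hω
  · rw [(B₁_eval ω _).1]
    simp only [Matrix.cons_val_zero, Matrix.cons_val_one, Matrix.cons_val_two, Matrix.head_cons,
      Matrix.tail_cons]
    linear_combination (ω ^ 2 - (ω) + 1) * hω
  · rw [(B₆_eval _).1]
    simp only [Matrix.cons_val_zero, Matrix.cons_val_one, Matrix.cons_val_two, Matrix.head_cons,
      Matrix.tail_cons]
    linear_combination (1) * hω
  · rw [(B₁_eval ω _).2, (B₆_eval _).2, cross_apply]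
    simp only [Matrix.smul_cons, Matrix.smul_empty, smul_eq_mul, Matrix.cons_val_zero,
      Matrix.cons_val_one, Matrix.cons_val_two, Matrix.head_cons,
      Matrix.tail_cons, vec3_eq_iff]
    refine ⟨?_, ?_, ?_⟩
    · linear_combination (6 * ω ^ 2 - 9 * ω) * hω
    · linear_combination (3 * ω ^ 2 - 3 * ω - 3) * hω
    · linear_combination (-3 * ω ^ 3 + 3 * ω ^ 2 - 6 * ω + 3) * hω
  · rw [(B₁_eval ω _).1]
    simp only [Matrix.cons_val_zero, Matrix.cons_val_one, Matrix.cons_val_two, Matrix.head_cons,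
      Matrix.tail_cons]
    linear_combination (ω ^ 3 - (ω ^ 2) + 1) * hω
  · rw [(B₆_eval _).1]
    simp only [Matrix.cons_val_zero, Matrix.cons_val_one, Matrix.cons_val_two, Matrix.head_cons,
      Matrix.tail_cons]
    linear_combination (1) * hω
  · rw [(B₁_eval ω _).2, (B₆_eval _).2, cross_apply]
    simp only [Matrix.smul_cons, Matrix.smul_empty, smul_eq_mul, Matrix.cons_val_zero,
      Matrix.cons_val_one, Matrix.cons_val_two, Matrix.head_cons,
      Matrix.tail_cons, vec3_eq_iff]
    refine ⟨?_, ?_, ?_⟩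
    · linear_combination (-3 * ω ^ 4 + 3 * ω ^ 3 - 6 * ω ^ 2 + 3 * ω + 9) * hω
    · linear_combination (6 * ω ^ 3 - 3 * ω ^ 2 - 3 * ω + 6) * hω
    · linear_combination (6) * hω

/-- **"… and are tangent on `T₃`"**: at `v₉ = (ε²,1,1), v₁₀ = (1,ε²,1), v₁₁ = (1,1,ε²)` both `B₁`
and `B₆` vanish, the vertex lies on the side `ℓ = x + y + εz`, `x + ε²y + ε²z`, `x + εy + z` of
`T₃ = E_{−3ε}` respectively, and `∇B₁ = c₁ℓ`, `∇B₆ = c₂ℓ` (`c₁ = 3ω, 3, 3`; `c₂ = −2ω−1, ω+2,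
−2ω−1`;
`ω² + ω + 1 = 0`). [cite: ArtebaniDolgachev2009, §5, Prop. 5.2 (iii) and the example after it] -/
theorem halphen_B₁_B₆_tangent_T₃ {ω : K} (hω : ω ^ 2 + ω + 1 = 0) :
      (eval ![ω ^ 2, (1 : K), 1] (𝐁₁[ω] : MvPolynomial (Fin 3) K) = 0 ∧ eval ![ω ^ 2, (1 : K), 1]
        (𝐁₆ : MvPolynomial (Fin 3) K) = 0 ∧ ![(1 : K), 1, ω] ⬝ᵥ ![ω ^ 2, (1 : K), 1] = 0 ∧
        (fun i => eval ![ω ^ 2, (1 : K), 1] (pderiv i (𝐁₁[ω] : MvPolynomial (Fin 3) K))) = (3 * ω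
          : K) • ![(1 : K), 1, ω] ∧
        (fun i => eval ![ω ^ 2, (1 : K), 1] (pderiv i (𝐁₆ : MvPolynomial (Fin 3) K))) = (-2 * ω -
          1 : K) • ![(1 : K), 1, ω]) ∧
      (eval ![(1 : K), ω ^ 2, 1] (𝐁₁[ω] : MvPolynomial (Fin 3) K) = 0 ∧ eval ![(1 : K), ω ^ 2, 1]
        (𝐁₆ : MvPolynomial (Fin 3) K) = 0 ∧ ![(1 : K), ω ^ 2, ω ^ 2] ⬝ᵥ ![(1 : K), ω ^ 2, 1] = 0 ∧
        (fun i => eval ![(1 : K), ω ^ 2, 1] (pderiv i (𝐁₁[ω] : MvPolynomial (Fin 3) K))) = (3 : K)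
          • ![(1 : K), ω ^ 2, ω ^ 2] ∧
        (fun i => eval ![(1 : K), ω ^ 2, 1] (pderiv i (𝐁₆ : MvPolynomial (Fin 3) K))) = (ω + 2 :
          K) • ![(1 : K), ω ^ 2, ω ^ 2]) ∧
      (eval ![(1 : K), 1, ω ^ 2] (𝐁₁[ω] : MvPolynomial (Fin 3) K) = 0 ∧ eval ![(1 : K), 1, ω ^ 2]
        (𝐁₆ : MvPolynomial (Fin 3) K) = 0 ∧ ![(1 : K), ω, 1] ⬝ᵥ ![(1 : K), 1, ω ^ 2] = 0 ∧
        (fun i => eval ![(1 : K), 1, ω ^ 2] (pderiv i (𝐁₁[ω] : MvPolynomial (Fin 3) K))) = (3 : K)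
          • ![(1 : K), ω, 1] ∧
        (fun i => eval ![(1 : K), 1, ω ^ 2] (pderiv i (𝐁₆ : MvPolynomial (Fin 3) K))) = (-2 * ω -
          1 : K) • ![(1 : K), ω, 1]) := by
  refine ⟨⟨?_, ?_, ?_, ?_, ?_⟩, ⟨?_, ?_, ?_, ?_, ?_⟩, ⟨?_, ?_, ?_, ?_, ?_⟩⟩
  · rw [(B₁_eval ω _).1]
    simp only [Matrix.cons_val_zero, Matrix.cons_val_one, Matrix.cons_val_two, Matrix.head_cons,
      Matrix.tail_cons]
    linear_combination (ω ^ 4 - (ω ^ 3) + ω) * hω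
  · rw [(B₆_eval _).1]
    simp only [Matrix.cons_val_zero, Matrix.cons_val_one, Matrix.cons_val_two, Matrix.head_cons,
      Matrix.tail_cons]
    linear_combination (ω ^ 2 - (ω) + 1) * hω
  · simp only [dotProduct, Fin.sum_univ_three, Matrix.cons_val_zero, Matrix.cons_val_one,
      Matrix.cons_val_two, Matrix.head_cons,
      Matrix.tail_cons]
    linear_combination (1) * hω
  · rw [(B₁_eval ω _).2]
    simp only [Matrix.smul_cons, Matrix.smul_empty, smul_eq_mul, Matrix.cons_val_zero,
      Matrix.cons_val_one, Matrix.cons_val_two, Matrix.head_cons,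
      Matrix.tail_cons, vec3_eq_iff]
    refine ⟨?_, ?_, ?_⟩
    · linear_combination (3 * ω ^ 2 - 3 * ω) * hω
    · ring
    · ring
  · rw [(B₆_eval _).2]
    simp only [Matrix.smul_cons, Matrix.smul_empty, smul_eq_mul, Matrix.cons_val_zero,
      Matrix.cons_val_one, Matrix.cons_val_two, Matrix.head_cons,
      Matrix.tail_cons, vec3_eq_iff]
    refine ⟨?_, ?_, ?_⟩
    · linear_combination (2) * hω
    · linear_combination (2) * hω
    · linear_combination (ω ^ 2 - (ω) + 2) * hω
  · rw [(B₁_eval ω _).1]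
    simp only [Matrix.cons_val_zero, Matrix.cons_val_one, Matrix.cons_val_two, Matrix.head_cons,
      Matrix.tail_cons]
    linear_combination (ω ^ 5 - (ω ^ 4) + ω ^ 2 - (ω) + 1) * hω
  · rw [(B₆_eval _).1]
    simp only [Matrix.cons_val_zero, Matrix.cons_val_one, Matrix.cons_val_two, Matrix.head_cons,
      Matrix.tail_cons]
    linear_combination (ω ^ 2 - (ω) + 1) * hω
  · simp only [dotProduct, Fin.sum_univ_three, Matrix.cons_val_zero, Matrix.cons_val_one,
      Matrix.cons_val_two, Matrix.head_cons,
      Matrix.tail_cons]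
    linear_combination (ω ^ 2 - (ω) + 1) * hω
  · rw [(B₁_eval ω _).2]
    simp only [Matrix.smul_cons, Matrix.smul_empty, smul_eq_mul, Matrix.cons_val_zero,
      Matrix.cons_val_one, Matrix.cons_val_two, Matrix.head_cons,
      Matrix.tail_cons, vec3_eq_iff]
    refine ⟨?_, ?_, ?_⟩
    · ring
    · linear_combination (3 * ω ^ 3 - 3 * ω ^ 2) * hω
    · ring
  · rw [(B₆_eval _).2]
    simp only [Matrix.smul_cons, Matrix.smul_empty, smul_eq_mul, Matrix.cons_val_zero,
      Matrix.cons_val_one, Matrix.cons_val_two, Matrix.head_cons,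
      Matrix.tail_cons, vec3_eq_iff]
    refine ⟨?_, ?_, ?_⟩
    · linear_combination (ω ^ 2 - (ω)) * hω
    · linear_combination (-(ω) + 1) * hω
    · linear_combination (-(ω) + 1) * hω
  · rw [(B₁_eval ω _).1]
    simp only [Matrix.cons_val_zero, Matrix.cons_val_one, Matrix.cons_val_two, Matrix.head_cons,
      Matrix.tail_cons]
    linear_combination (ω ^ 6 - (ω ^ 5) + ω ^ 3 - (ω ^ 2) + 1) * hω
  · rw [(B₆_eval _).1]
    simp only [Matrix.cons_val_zero, Matrix.cons_val_one, Matrix.cons_val_two, Matrix.head_cons,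
      Matrix.tail_cons]
    linear_combination (ω ^ 2 - (ω) + 1) * hω
  · simp only [dotProduct, Fin.sum_univ_three, Matrix.cons_val_zero, Matrix.cons_val_one,
      Matrix.cons_val_two, Matrix.head_cons,
      Matrix.tail_cons]
    linear_combination (1) * hω
  · rw [(B₁_eval ω _).2]
    simp only [Matrix.smul_cons, Matrix.smul_empty, smul_eq_mul, Matrix.cons_val_zero,
      Matrix.cons_val_one, Matrix.cons_val_two, Matrix.head_cons,
      Matrix.tail_cons, vec3_eq_iff]
    refine ⟨?_, ?_, ?_⟩
    · ring
    · ring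
    · linear_combination (3 * ω ^ 4 - 3 * ω ^ 3 + 3 * ω - 3) * hω
  · rw [(B₆_eval _).2]
    simp only [Matrix.smul_cons, Matrix.smul_empty, smul_eq_mul, Matrix.cons_val_zero,
      Matrix.cons_val_one, Matrix.cons_val_two, Matrix.head_cons,
      Matrix.tail_cons, vec3_eq_iff]
    refine ⟨?_, ?_, ?_⟩
    · linear_combination (2) * hω
    · linear_combination (ω ^ 2 - (ω) + 2) * hω
    · linear_combination (2) * hω

/-! ## §4 Non-degeneracy of the scalars -/

/-- For `3 ≠ 0` and `ω² + ω + 1 = 0` the scalars of §1–§3 are non-zero: `2ω + 1 ≠ 0`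
(`(2ω+1)² = −3`), `ω + 2 ≠ 0` and `ω − 1 ≠ 0` (`(ω+2)(1−ω) = 3`), `ω ≠ 0`, `ω + 1 = −ω² ≠ 0`,
`9 ≠ 0` — so the transversal intersections are transversal and the tangent gradients non-zero.
[cite: ArtebaniDolgachev2009, §5, Prop. 5.2] -/
theorem halphen_configuration_scalars_ne_zero (h3 : (3 : K) ≠ 0) {ω : K}
    (hω : ω ^ 2 + ω + 1 = 0) :
    2 * ω + 1 ≠ 0 ∧ ω + 2 ≠ 0 ∧ ω - 1 ≠ 0 ∧ ω ≠ 0 ∧ ω + 1 ≠ 0 ∧ (9 : K) ≠ 0 := by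
  have hω0 : ω ≠ 0 := by
    rintro rfl
    norm_num at hω
  refine ⟨fun h => h3 ?_, fun h => h3 ?_, fun h => h3 ?_, hω0,
    fun h => pow_ne_zero 2 hω0 (by linear_combination hω - h), ?_⟩
  · linear_combination (-(2 * ω) - 1) * h + 4 * hω
  · linear_combination (1 - ω) * h + hω
  · linear_combination (-(ω) - 2) * h + hω
  · rw [show (9 : K) = 3 * 3 by norm_num]
    exact mul_ne_zero h3 h3

end HalphenConfiguration

end Literature.AlgebraicGeometry.PlaneCurves
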